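import Summits.AtomisticToContinuum.FouriersLaw.Theses.EmbeddedDrudeMourre
import Literature.MathematicalPhysics.KineticTheory.InfiniteChainSuperstableDynamics
import Summits.AtomisticToContinuum.FouriersLaw.Theorems.EmbeddedDrudeMourreDrudeDissolutionOfBmKineticCruxes
import Summits.AtomisticToContinuum.FouriersLaw.Theorems.EmbeddedDrudeMourreDrudeDissolutionStubBmRigidity

/-!
# Typed companions of `STRATEGY-CENSUS.md` (s2) for crux `DrudeDissolution` (stmt-AtomisticToContinuum-12593)

Strategist workfile (planner-cstrat-stmt-AtomisticToContinuum-12593-s2-0, 2026-08-17). Nothing here is a route item or a stub; the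
`def … : Prop`s are the census's S⁺ / barrier statements TYPED over tree vocabulary so that later seats can quote them by name, plus the
two split children (byte-identical with `SPLIT-READY.md` / the twin's `SPLIT-PACKAGE.md`) and the proved relations among them:

* `BmPostKineticTail`, `BmKineticLimit` — the split children (§Decomposition D1);
* `drudeDissolution_of_subs` — the glue, = landed p127311 ∘ p127446 (also `Cruxes/DrudeDissolution/StrategistSplit.lean`);
* `KineticLimitUniformInM` (S⁺₈) and `bmKineticLimit_of_uniformInM : S⁺₈ → BmKineticLimit` (the trivial direction; the census
  explains why S⁺₈ is the wall in window dress and NOT a substitute for child 1);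
* `AbsoluteSpaceTimeSummability` (S⁺₁₀) — PREDICTED FALSE in kind (diffusive energy mode: `Σ_x |⟨j_0; j_x(t)⟩| ≍ 1/t`); typed only
  so that the barrier note "AbsoluteSpaceTimeSummabilityFalse" has a precise referent; `currentCorrelation_abs_le_tsum_abs` records the
  one-line reason it would have implied child 1's integrand bound (`|C_T(t)| ≤ Σ_x |⟨j_0 (j_x∘φ_t)⟩|`).
lean check rc 0, 0 sorries.
-/

noncomputable section

open MeasureTheory Set Filter

namespace Summit.AtomisticToContinuum.FouriersLaw.Cruxes.DrudeDissolution.CensusS2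

open Literature.MathematicalPhysics.KineticTheory.HeatConduction

/-- Split child 1 (the wall): T-uniform far-tail smallness of the canonical `C_T` beyond every kinetic multiple, ∃-BM form. -/
def BmPostKineticTail : Prop :=
  ∀ ω₂ lam β γ : ℝ, 0 < ω₂ → 0 < lam → 0 < β → 0 < γ → ∀ e : ℝ, 0 < e → ∃ M T₀ : ℝ, 0 < M ∧ 0 < T₀ ∧ ∀ T : ℝ, 0 < T → T < T₀ → ∃ (μ : MeasureTheory.Measure Literature.MathematicalPhysics.KineticTheory.HeatConduction.ChainConfig) (D : Literature.MathematicalPhysics.KineticTheory.HeatConduction.InfiniteChainDynamics (Literature.MathematicalPhysics.KineticTheory.HeatConduction.pinnedChain ω₂ lam β γ)), (Literature.MathematicalPhysics.KineticTheory.HeatConduction.pinnedChain ω₂ lam β γ).IsChainGibbsMeasure T μ ∧ MeasureTheory.MeasurePreserving (fun σ : Literature.MathematicalPhysics.KineticTheory.HeatConduction.ChainConfig => fun i : ℤ => σ (i + 1)) μ μ ∧ D.carrier = (Literature.MathematicalPhysics.KineticTheory.HeatConduction.pinnedChain ω₂ lam β γ).bmGood ∧ D.PreservesMeasure μ ∧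 MeasureTheory.IntegrableOn (D.currentCorrelation μ) (Set.Ioi (M / T ^ 2)) ∧ ∫ t in Set.Ioi (M / T ^ 2), |D.currentCorrelation μ t| ≤ e

/-- Split child 2: the wave-kinetic limit on every finite kinetic window, ∃-BM form (`∫K > 0` is already a theorem of the tree). -/
def BmKineticLimit : Prop :=
  ∀ ω₂ lam β γ : ℝ, 0 < ω₂ → 0 < lam → 0 < β → 0 < γ → ∃ K : ℝ → ℝ, MeasureTheory.IntegrableOn K (Set.Ioi 0) ∧ 0 < ∫ τ in Set.Ioi 0, K τ ∧ ∀ δ M e : ℝ, 0 < δ → δ ≤ M → 0 < e → ∃ T₀ : ℝ, 0 < T₀ ∧ ∀ T : ℝ, 0 < T → T < T₀ → ∃ (μ : MeasureTheory.Measure Literature.MathematicalPhysics.KineticTheory.HeatConduction.ChainConfig) (D : Literature.MathematicalPhysics.KineticTheory.HeatConduction.InfiniteChainDynamics (Literature.MathematicalPhysics.KineticTheory.HeatConduction.pinnedChain ω₂ lam β γ)), (Literature.MathematicalPhysics.KineticTheory.HeatConduction.pinnedChain ω₂ lam β γ).IsChainGibbsMeasure T μ ∧ MeasureTheory.MeasurePreserving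 (fun σ : Literature.MathematicalPhysics.KineticTheory.HeatConduction.ChainConfig => fun i : ℤ => σ (i + 1)) μ μ ∧ D.carrier = (Literature.MathematicalPhysics.KineticTheory.HeatConduction.pinnedChain ω₂ lam β γ).bmGood ∧ D.PreservesMeasure μ ∧ |(∫ t in (δ / T ^ 2)..(M / T ^ 2), D.currentCorrelation μ t) - ∫ τ in δ..M, K τ| ≤ e

/-- **The split glue** `BmPostKineticTail → BmKineticLimit → DrudeDissolution` — landed p127311 with its rigidity hypothesis
discharged by landed p127446 (= `StrategistSplit.drudeDissolution_of_subs`). [folklore] -/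
theorem drudeDissolution_of_subs :
    BmPostKineticTail → BmKineticLimit →
      Summit.AtomisticToContinuum.FouriersLaw.Theses.EmbeddedDrudeMourre.DrudeDissolution :=
  fun h₁ h₂ =>
    Summit.AtomisticToContinuum.FouriersLaw.Theorems.DrudeDissolution.LineSketch.drudeDissolution_of_bmRigidity_of_bmPostKineticTail_of_bmKineticLimit
      Summit.AtomisticToContinuum.FouriersLaw.Theorems.DrudeDissolution.LineSketch.stub_bmRigidity h₁ h₂

/-- **S⁺₈ `KineticLimitUniformInM`** — child 2 with the kinetic multiple `M` quantified AFTER the threshold `T₀`: window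
convergence uniform in `M ∈ [δ, ∞)`. Census verdict: the wall in window dress (uniformity in `M` up to `∞` at fixed `T` is
`t = ∞` control); it implies child 2 (`bmKineticLimit_of_uniformInM`) and T-uniform Cauchy control of the SIGNED kinetic-window
integrals, but not the absolute tail mass of child 1. Not filed. -/
def KineticLimitUniformInM : Prop :=
  ∀ ω₂ lam β γ : ℝ, 0 < ω₂ → 0 < lam → 0 < β → 0 < γ → ∃ K : ℝ → ℝ, MeasureTheory.IntegrableOn K (Set.Ioi 0) ∧ 0 < ∫ τ in Set.Ioi 0, K τ ∧ ∀ δ e : ℝ, 0 < δ → 0 < e → ∃ T₀ : ℝ, 0 < T₀ ∧ ∀ T : ℝ, 0 < T → T < T₀ → ∀ M : ℝ, δ ≤ M → ∃ (μ : MeasureTheory.Measure Literature.MathematicalPhysics.KineticTheory.HeatConduction.ChainConfig) (D : Literature.MathematicalPhysics.KineticTheory.HeatConduction.InfiniteChainDynamics (Literature.MathematicalPhysics.KineticTheory.HeatConduction.pinnedChain ω₂ lam β γ)), (Literature.MathematicalPhysics.KineticTheory.HeatConduction.pinnedChain ω₂ lam β γ).IsChainGibbsMeasure T μ ∧ MeasureTheory.MeasurePreserving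 (fun σ : Literature.MathematicalPhysics.KineticTheory.HeatConduction.ChainConfig => fun i : ℤ => σ (i + 1)) μ μ ∧ D.carrier = (Literature.MathematicalPhysics.KineticTheory.HeatConduction.pinnedChain ω₂ lam β γ).bmGood ∧ D.PreservesMeasure μ ∧ |(∫ t in (δ / T ^ 2)..(M / T ^ 2), D.currentCorrelation μ t) - ∫ τ in δ..M, K τ| ≤ e

/-- S⁺₈ ⇒ child 2 (instantiate the multiple). [folklore] -/
theorem bmKineticLimit_of_uniformInM : KineticLimitUniformInM → BmKineticLimit := by
  intro h ω₂ lam β γ hω hl hβ hγ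
  obtain ⟨K, hK, hpos, hw⟩ := h ω₂ lam β γ hω hl hβ hγ
  refine ⟨K, hK, hpos, fun δ M e hδ hδM he => ?_⟩
  obtain ⟨T₀, hT₀, hT⟩ := hw δ e hδ he
  exact ⟨T₀, hT₀, fun T hTpos hTlt => hT T hTpos hTlt M hδM⟩

/-- **S⁺₁₀ `AbsoluteSpaceTimeSummability`** — the natural output shape of space-time cluster expansions with positive weights:
`t ↦ Σ_x |∫ j_0 (j_x ∘ φ_t) dμ_T|` integrable on `(0, ∞)` for the canonical BM datum at small `T`. Census verdict: PREDICTED FALSE in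
kind whenever the chain conducts normally (one diffusive conserved field ⇒ `⟨j_0(0) j_x(t)⟩ ≈ D²χ ∂ₓ²G_t(x)`, whose `ℓ¹`-norm in `x`
is `≍ 1/t`), although the SIGNED sum `C_T(t)` cancels at this order. Typed only as the referent of the barrier note
"AbsoluteSpaceTimeSummabilityFalse"; never to be filed. -/
def AbsoluteSpaceTimeSummability : Prop :=
  ∀ ω₂ lam β γ : ℝ, 0 < ω₂ → 0 < lam → 0 < β → 0 < γ → ∃ T₀ : ℝ, 0 < T₀ ∧ ∀ T : ℝ, 0 < T → T < T₀ → ∃ (μ : MeasureTheory.Measure Literature.MathematicalPhysics.KineticTheory.HeatConduction.ChainConfig) (D : Literature.MathematicalPhysics.KineticTheory.HeatConduction.InfiniteChainDynamics (Literature.MathematicalPhysics.KineticTheory.HeatConduction.pinnedChain ω₂ lam β γ)), (Literature.MathematicalPhysics.KineticTheory.HeatConduction.pinnedChain ω₂ lam β γ).IsChainGibbsMeasure T μ ∧ MeasureTheory.MeasurePreserving (fun σ : Literature.MathematicalPhysics.KineticTheory.HeatConduction.ChainConfig => fun i : ℤ => σ (i + 1)) μ μ ∧ D.carrier = (Literature.MathematicalPhysics.KineticTheory.HeatConduction.pinnedChain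 ω₂ lam β γ).bmGood ∧ D.PreservesMeasure μ ∧ (∀ t : ℝ, D.HasAbsConvergentCorrelation μ t) ∧ MeasureTheory.IntegrableOn (fun t : ℝ => ∑' x : ℤ, |∫ σ, (Literature.MathematicalPhysics.KineticTheory.HeatConduction.pinnedChain ω₂ lam β γ).bondCurrentZ σ 0 * (Literature.MathematicalPhysics.KineticTheory.HeatConduction.pinnedChain ω₂ lam β γ).bondCurrentZ (D.flow t σ) x ∂μ|) (Set.Ioi 0)

/-- The one-line reason S⁺₁₀ would have dominated child 1's integrand: `|C_T(t)| ≤ Σ_x |∫ j_0 (j_x∘φ_t) dμ|` whenever the sum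
converges absolutely. [folklore] -/
theorem currentCorrelation_abs_le_tsum_abs {ω₂ lam β γ : ℝ}
    (D : InfiniteChainDynamics (pinnedChain ω₂ lam β γ)) (μ : Measure ChainConfig) (t : ℝ)
    (h : D.HasAbsConvergentCorrelation μ t) :
    |D.currentCorrelation μ t| ≤
      ∑' x : ℤ, |∫ σ, (pinnedChain ω₂ lam β γ).bondCurrentZ σ 0 *
        (pinnedChain ω₂ lam β γ).bondCurrentZ (D.flow t σ) x ∂μ| := by
  unfold InfiniteChainDynamics.currentCorrelation
  have hs := h.2
  calc |∑' x : ℤ, ∫ σ, (pinnedChain ω₂ lam β γ).bondCurrentZ σ 0 *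
          (pinnedChain ω₂ lam β γ).bondCurrentZ (D.flow t σ) x ∂μ|
      = ‖∑' x : ℤ, ∫ σ, (pinnedChain ω₂ lam β γ).bondCurrentZ σ 0 *
          (pinnedChain ω₂ lam β γ).bondCurrentZ (D.flow t σ) x ∂μ‖ := (Real.norm_eq_abs _).symm
    _ ≤ ∑' x : ℤ, ‖∫ σ, (pinnedChain ω₂ lam β γ).bondCurrentZ σ 0 *
          (pinnedChain ω₂ lam β γ).bondCurrentZ (D.flow t σ) x ∂μ‖ := by
        apply norm_tsum_le_tsum_norm
        simpa [Real.norm_eq_abs] using hs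
    _ = ∑' x : ℤ, |∫ σ, (pinnedChain ω₂ lam β γ).bondCurrentZ σ 0 *
          (pinnedChain ω₂ lam β γ).bondCurrentZ (D.flow t σ) x ∂μ| := by
        simp [Real.norm_eq_abs]

end Summit.AtomisticToContinuum.FouriersLaw.Cruxes.DrudeDissolution.CensusS2

end
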